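/-
Copyright: the b2b-balaban cell (near-miss cell 7), T⁴-continuum fan-out; row NE7b ROUND-2 swarm, seat
t4-ne7b-formalise-leaf-10 (gen 3; sub-row S6g′(f) of `t4/b2b-balaban-t4-ne7b-p1/LEAVES-NE7b.md`, owner's ruling
R-OWNER-22-12 (2)).  Released under the licence of the surrounding project.
-/
import Summits.QuantumFields.BalabanUV.T4Continuum.Support.HistoryJoinsClass
import Summits.QuantumFields.BalabanUV.T4Continuum.Support.HistorySiblingEntropyBound

/-!
# Sibling entropy bound, the BRIDGE (part 1 of 2): from a shape tree with its cluster parts (`HistoryJoins.jparts`,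
# `HistoryJoinsClass.csize`) to the abstract shapes of `HistorySiblingEntropyBound` — the map, the displayed
# encoding predicates, well-formedness and canonicity (row S6g′(f))

Summits-side support leaf of the T⁴-continuum cell (rung (B)+1 on a FINITE torus only; NOT infinite volume, NOT the
mass gap, NOT the Clay statement; NOT a proof of the spine estimate NE7b).  Row NE7b, route «COUNT», row S6g′
«MASS-BASED SIBLING COUNT» (R-OWNER-22-12 (2)).  [folklore] structural∕well-founded recursion over the lineage's own
carrier `Gen ε` and finite sums; nothing is quoted from print, nothing printed is asserted, no `[cite:]` tag, no `Prop`
fact minted.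

WHAT.  §1 **`toShape st fat G`** (births `born b j ↦ atom j (fat b)`; renewals transparent; a merger ↦ `join (st e + 1)
(shape of the host part) (shapes of the non-host parts of its top join, in index order)` — the join step is shifted by
one so that a new region joining at its birth step is a well-formed part of age `2`), and in the binding's letters the
well-founded sums **`E`** (sibling entropy: `Σ_i E (part i) + logMultinomial univ csize` at a merger), **`AG`** (shifted
ages: `Σ_i AG (part i) + Σ_{i ≠ h} ((st e + 2 − rootStep (part i)) + 1)`), **`NH`** (number of non-host parts over all
joins), and the three DISPLAYED encoding predicates **`Mono`** (steps do not decrease rootward, births read by their node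
step), **`ShapeSorted`** (every join lists its non-host parts in `enc ∘ toShape`-sorted order — THE convention of
journal l.9428∕l.9699) and **`InjParts`** (parts of one join with equal shapes are equal sub-structures — renewal and
label data are determined; true for canonically encoded realised members, displayed here).  §2 `toShape_root`, the cluster
lemmas (`mono_of_mem_clusterParts`, `top_le_of_mem_clusterParts`, `st_ne_of_mem_clusterParts` = cluster maximality),
**`wf_toShape`** (⇐ `Mono`), **`canon_toShape`** (⇐ `ShapeSorted`).  Part 2 `HistorySiblingEntropyDischarge`:
`phi_toShape` (`= bsum (1 + fat) + AG`), `ent_toShape` (`= E` ⇐ `InjParts`), `AG_le` (`≤ partnerAges + 2·NH`, the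
tournament identity) and **`E_le`**: `Mono → ShapeSorted → InjParts → E G ≤ 2·bsum (1 + fat) G + 2·partnerAges st G +
4·NH st G` — the discharge of the typer's display `hent` (ACCEPT-A12I v1.5 (3)) for canonically encoded members.

HONEST SCOPE.  The three encoding predicates are displayed, not derived here (they concern leaf-08∕leaf-09's `toPGen`∕
`genT` encoding: chronology with `j = st b` at births, shape-first chain order, canonical labels∕renewals); nothing of
H3∕(B)∕BetaPertH is touched.  NE7b NOT proved.  HONEST DEPENDENCY (cell): continuum YM on T⁴ ⇐ BetaPertH ∧ nine spine
estimates (0/9 proved); BetaPertH ⇐ (D1) ∧ (D4) ∧ CAP+tail; G-an2-4 gates asym, D1 and NE2/3/4.  This file changes none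
of it.
-/
open Finset
open Literature.MathematicalPhysics.QuantumFieldTheory.Balaban1983to89
open T4PersistenceDictionary T4PartnerMultiplicity T4BranchingRecordsGas
open Summit.QuantumFields.BalabanUV.T4Continuum.HistoryJoins
open Summit.QuantumFields.BalabanUV.T4Continuum.HistoryJoinsAdm
open Summit.QuantumFields.BalabanUV.T4Continuum.HistoryJoinsClass
open Summit.QuantumFields.BalabanUV.T4Continuum.HistorySiblingEntropy
open Summit.QuantumFields.BalabanUV.T4Continuum.HistorySiblingEntropyBound

namespace Summit.QuantumFields.BalabanUV.T4Continuum.HistorySiblingEntropyBridge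

noncomputable section

open scoped Classical


/-! ## §1 The shape of a genealogy and the sums in the binding's letters -/

/-- parts from a list of shapes [folklore] -/
def ofList : List Shape → Parts
  | [] => .nil
  | x :: l => .cons x (ofList l)

/-- `ofList` is a right inverse of `toList` [folklore] -/
@[simp] theorem toList_ofList : ∀ l : List Shape, (ofList l).toList = l
  | [] => rfl
  | x :: l => by simp [ofList, Parts.toList, toList_ofList l]

variable {ε : Type*} (st : ε → ℕ) (fat : ε → ℕ)

/-- the non-host indices of the top join of a merger, in index order [folklore] -/
def nonhost (X Y : Gen ε) (e : ε) : List (Fin (npart st (Gen.merge X Y e))) :=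
  (List.finRange _).filter fun i => i ≠ hostIdx st X Y e

/-- membership in `nonhost` [folklore] -/
@[simp] theorem mem_nonhost {X Y : Gen ε} {e : ε} {i : Fin (npart st (Gen.merge X Y e))} :
    i ∈ nonhost st X Y e ↔ i ≠ hostIdx st X Y e := by
  simp [nonhost]

/-- `nonhost` has no duplicates [folklore] -/
theorem nodup_nonhost (X Y : Gen ε) (e : ε) : (nonhost st X Y e).Nodup :=
  (List.nodup_finRange _).filter _

/-- the finset of `nonhost` is the filter `≠ host` [folklore] -/
theorem toFinset_nonhost (X Y : Gen ε) (e : ε) :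
    (nonhost st X Y e).toFinset = univ.filter fun i => i ≠ hostIdx st X Y e := by
  ext i; simp [nonhost]

/-- a sum over the list `nonhost` is the sum over the non-host indices [folklore] -/
theorem sum_nonhost {M : Type*} [AddCommMonoid M] (X Y : Gen ε) (e : ε) (f : Fin (npart st (Gen.merge X Y e)) → M) :
    ((nonhost st X Y e).map f).sum = ∑ i ∈ univ.filter (fun i => i ≠ hostIdx st X Y e), f i := by
  rw [← toFinset_nonhost, List.sum_toFinset _ (nodup_nonhost st X Y e)]

/-- **THE SHAPE OF A GENEALOGY** (join steps shifted by one; renewals transparent). [folklore] -/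
def toShape : Gen ε → Shape
  | Gen.born b j => .atom j (fat b)
  | Gen.renew G _ _ => toShape G
  | Gen.merge X Y e =>
      .join (st e + 1) (toShape (part st (Gen.merge X Y e) (hostIdx st X Y e)).2)
        (ofList ((nonhost st X Y e).map fun i => toShape (part st (Gen.merge X Y e) i).2))
termination_by G => gsize G
decreasing_by
  all_goals first
    | (simp only [gsize]; omega)
    | exact gsize_lt_of_mem_jparts st _ _ (part_mem st _ _)

/-- unfolding at a birth [folklore] -/
@[simp] theorem toShape_born (b : ε) (j : ℕ) : toShape st fat (Gen.born b j) = .atom j (fat b) := by rw [toShape]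

/-- unfolding at a renewal [folklore] -/
@[simp] theorem toShape_renew (G : Gen ε) (e : ε) (h : ℕ) : toShape st fat (Gen.renew G e h) = toShape st fat G := by
  rw [toShape]

/-- unfolding at a merger [folklore] -/
theorem toShape_merge (X Y : Gen ε) (e : ε) :
    toShape st fat (Gen.merge X Y e) =
      .join (st e + 1) (toShape st fat (part st (Gen.merge X Y e) (hostIdx st X Y e)).2)
        (ofList ((nonhost st X Y e).map fun i => toShape st fat (part st (Gen.merge X Y e) i).2)) := by
  rw [toShape]

/-- **THE SIBLING ENTROPY IN THE BINDING'S LETTERS**: the log-multinomial of the class sizes `csize` at every join.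
[folklore] -/
def E : Gen ε → ℝ
  | Gen.born _ _ => 0
  | Gen.renew G _ _ => E G
  | Gen.merge X Y e => (∑ i, E (part st (Gen.merge X Y e) i).2) + logMultinomial univ (csize st X Y e)
termination_by G => gsize G
decreasing_by
  all_goals first
    | (simp only [gsize]; omega)
    | exact gsize_lt_of_mem_jparts st _ _ (part_mem st _ _)

/-- **THE SHIFTED AGES**: `Σ_joins Σ_{non-host parts} ((step + 2 − rootStep part) + 1)`. [folklore] -/
def AG : Gen ε → ℕ
  | Gen.born _ _ => 0
  | Gen.renew G _ _ => AG G
  | Gen.merge X Y e => (∑ i, AG (part st (Gen.merge X Y e) i).2) +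
      ∑ i ∈ univ.filter (fun i => i ≠ hostIdx st X Y e), ((st e + 1 + 1 - (part st (Gen.merge X Y e) i).2.rootStep) + 1)
termination_by G => gsize G
decreasing_by
  all_goals first
    | (simp only [gsize]; omega)
    | exact gsize_lt_of_mem_jparts st _ _ (part_mem st _ _)

/-- **THE NUMBER OF NON-HOST PARTS over all joins** [folklore] -/
def NH : Gen ε → ℕ
  | Gen.born _ _ => 0
  | Gen.renew G _ _ => NH G
  | Gen.merge X Y e => (∑ i, NH (part st (Gen.merge X Y e) i).2) + (npart st (Gen.merge X Y e) - 1)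
termination_by G => gsize G
decreasing_by
  all_goals first
    | (simp only [gsize]; omega)
    | exact gsize_lt_of_mem_jparts st _ _ (part_mem st _ _)

/-- the step of the top event (births: the node step; renewals: the renewal step) [folklore] -/
def top : Gen ε → ℕ
  | Gen.born _ j => j
  | Gen.renew _ e _ => st e
  | Gen.merge _ _ e => st e

/-- **DISPLAY 1 — MONOTONE STEPS**: at every merger both partners' top steps are at most the merger's step (births
read by their node step), and a renewal is recorded STRICTLY after its line's top event (so a renewal never sits inside
a same-step cluster — leaf-02 gen 3's `Dated` strictness). [folklore] -/
def Mono : Gen ε → Prop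
  | Gen.born _ _ => True
  | Gen.renew G e _ => Mono G ∧ top st G < st e
  | Gen.merge X Y e => Mono X ∧ Mono Y ∧ top st X ≤ st e ∧ top st Y ≤ st e

/-- **DISPLAY 2 — SHAPE-SORTED JOIN LISTS** (the encoding convention): every join lists its non-host parts in
`enc ∘ toShape`-sorted order. [folklore] -/
def ShapeSorted : Gen ε → Prop
  | Gen.born _ _ => True
  | Gen.renew G _ _ => ShapeSorted G
  | Gen.merge X Y e => (∀ i, ShapeSorted (part st (Gen.merge X Y e) i).2) ∧
      ((nonhost st X Y e).map fun i => toShape st fat (part st (Gen.merge X Y e) i).2).Pairwise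
        fun x y => enc x ≤ enc y
termination_by G => gsize G
decreasing_by
  all_goals first
    | (simp only [gsize]; omega)
    | exact gsize_lt_of_mem_jparts st _ _ (part_mem st _ _)

/-- **DISPLAY 3 — EQUAL SHAPES ARE EQUAL PARTS** at every join (labels, renewals and bracketing are canonical).
[folklore] -/
def InjParts : Gen ε → Prop
  | Gen.born _ _ => True
  | Gen.renew G _ _ => InjParts G
  | Gen.merge X Y e => (∀ i, InjParts (part st (Gen.merge X Y e) i).2) ∧
      ∀ i j, i ≠ hostIdx st X Y e → j ≠ hostIdx st X Y e →
        toShape st fat (part st (Gen.merge X Y e) i).2 = toShape st fat (part st (Gen.merge X Y e) j).2 →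
          (part st (Gen.merge X Y e) i).2 = (part st (Gen.merge X Y e) j).2
termination_by G => gsize G
decreasing_by
  all_goals first
    | (simp only [gsize]; omega)
    | exact gsize_lt_of_mem_jparts st _ _ (part_mem st _ _)

/-! ## §2 The bridge lemmas -/

/-- the root is the root step [folklore] -/
theorem toShape_root : ∀ G : Gen ε, (toShape st fat G).root = G.rootStep
  | Gen.born b j => by simp [Shape.root]
  | Gen.renew G e h => by rw [toShape_renew, toShape_root G]; rfl
  | Gen.merge X Y e => by
      rw [toShape_merge, Shape.root, toShape_root (part st (Gen.merge X Y e) (hostIdx st X Y e)).2,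
        ← rootStep_eq_host]
termination_by G => gsize G
decreasing_by
  all_goals first
    | (simp only [gsize]; omega)
    | exact gsize_lt_of_mem_jparts st _ _ (part_mem st _ _)


/-! ### Cluster lemmas -/

/-- parts of a `Mono` structure are `Mono` [folklore] -/
theorem mono_of_mem_clusterParts (t : ℕ) : ∀ (G : Gen ε), Mono st G → ∀ q ∈ clusterParts st t G, Mono st q.2
  | Gen.born b j, _, q, hq => by simp at hq; subst hq; trivial
  | Gen.renew G e h, hm, q, hq => by simp at hq; subst hq; exact hm
  | Gen.merge X Y e, hm, q, hq => by
      by_cases he : st e = t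
      · rw [clusterParts_merge_of_eq st he, List.mem_append, List.mem_map, List.mem_map] at hq
        rcases hq with ⟨q', hq', rfl⟩ | ⟨q', hq', rfl⟩
        · exact mono_of_mem_clusterParts t X hm.1 q' hq'
        · exact mono_of_mem_clusterParts t Y hm.2.1 q' hq'
      · rw [clusterParts_merge_of_ne st he, List.mem_singleton] at hq
        subst hq; exact hm

/-- parts of the step-`t` cluster of a `Mono` structure with top `≤ t` have top `≤ t` [folklore] -/
theorem top_le_of_mem_clusterParts (t : ℕ) :
    ∀ (G : Gen ε), Mono st G → top st G ≤ t → ∀ q ∈ clusterParts st t G, top st q.2 ≤ t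
  | Gen.born b j, _, ht, q, hq => by simp at hq; subst hq; exact ht
  | Gen.renew G e h, _, ht, q, hq => by simp at hq; subst hq; exact ht
  | Gen.merge X Y e, hm, ht, q, hq => by
      by_cases he : st e = t
      · rw [clusterParts_merge_of_eq st he, List.mem_append, List.mem_map, List.mem_map] at hq
        simp only [Mono] at hm
        rcases hq with ⟨q', hq', rfl⟩ | ⟨q', hq', rfl⟩
        · exact top_le_of_mem_clusterParts t X hm.1 (by rw [← he]; exact hm.2.2.1) q' hq'
        · exact top_le_of_mem_clusterParts t Y hm.2.1 (by rw [← he]; exact hm.2.2.2) q' hq'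
      · rw [clusterParts_merge_of_ne st he, List.mem_singleton] at hq
        subst hq; exact ht

/-- **CLUSTER MAXIMALITY**: a part of the step-`t` cluster that is a merger has a different step. [folklore] -/
theorem st_ne_of_mem_clusterParts (t : ℕ) :
    ∀ (G : Gen ε), ∀ q ∈ clusterParts st t G, ∀ (X' Y' : Gen ε) (e' : ε), q.2 = Gen.merge X' Y' e' → st e' ≠ t
  | Gen.born b j, q, hq, X', Y', e', h => by simp at hq; subst hq; simp at h
  | Gen.renew G e hh, q, hq, X', Y', e', h => by simp at hq; subst hq; simp at h
  | Gen.merge X Y e, q, hq, X', Y', e', h => by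
      by_cases he : st e = t
      · rw [clusterParts_merge_of_eq st he, List.mem_append, List.mem_map, List.mem_map] at hq
        rcases hq with ⟨q', hq', rfl⟩ | ⟨q', hq', rfl⟩
        · exact st_ne_of_mem_clusterParts t X q' hq' X' Y' e' h
        · exact st_ne_of_mem_clusterParts t Y q' hq' X' Y' e' h
      · rw [clusterParts_merge_of_ne st he, List.mem_singleton] at hq
        subst hq
        simp only [Gen.merge.injEq] at h
        rw [← h.2.2]; exact he

/-- the last event of the shape is at most the top step (plus one at a merger), under `Mono` [folklore] -/
theorem last_toShape_le : ∀ G : Gen ε, Mono st G →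
    (toShape st fat G).last ≤ top st G + (match G with | Gen.merge _ _ _ => 1 | _ => 0)
  | Gen.born b j, _ => by simp [Shape.last, top]
  | Gen.renew G e h, hm => by
      simp only [Mono] at hm
      have ih := last_toShape_le G hm.1
      rw [toShape_renew]
      have : (match (G : Gen ε) with | Gen.merge _ _ _ => 1 | _ => 0) ≤ 1 := by
        cases G <;> simp
      simp only [top]
      omega
  | Gen.merge X Y e, _ => by rw [toShape_merge]; simp [Shape.last, top]

/-- a part of the top join of a `Mono` merger has its shape's last event at most the join step [folklore] -/
theorem last_part_le {X Y : Gen ε} {e : ε} (hm : Mono st (Gen.merge X Y e)) (i : Fin (npart st (Gen.merge X Y e))) :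
    (toShape st fat (part st (Gen.merge X Y e) i).2).last ≤ st e := by
  have hq : part st (Gen.merge X Y e) i ∈ clusterParts st (st e) (Gen.merge X Y e) := part_mem st _ i
  have hmq := mono_of_mem_clusterParts st (st e) _ hm _ hq
  have htq := top_le_of_mem_clusterParts st (st e) _ hm (by simp [top]) _ hq
  have hl := last_toShape_le st fat _ hmq
  generalize hq2 : (part st (Gen.merge X Y e) i).2 = q at hmq htq hl hq
  cases q with
  | born b j =>
      rw [toShape_born]
      simp only [top] at htq
      exact htq
  | renew G e' h =>
      rw [toShape_renew]
      rw [toShape_renew] at hl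
      simp only [top] at hl htq
      omega
  | merge X' Y' e' =>
      have hne := st_ne_of_mem_clusterParts st (st e) _ _ hq X' Y' e' hq2
      rw [toShape_merge]
      simp only [top] at htq
      simp only [Shape.last]
      omega

/-- **WELL-FORMEDNESS OF THE SHAPE** from the displayed chronology. [folklore] -/
theorem wf_toShape : ∀ G : Gen ε, Mono st G → (toShape st fat G).WF
  | Gen.born b j, _ => by simp [Shape.WF]
  | Gen.renew G e h, hm => by rw [toShape_renew]; exact wf_toShape G hm.1
  | Gen.merge X Y e, hm => by
      rw [toShape_merge]
      have hparts : ∀ i, (toShape st fat (part st (Gen.merge X Y e) i).2).WF := fun i =>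
        wf_toShape (part st (Gen.merge X Y e) i).2 (mono_of_mem_clusterParts st (st e) _ hm _ (part_mem st _ i))
      refine ⟨hparts _, Nat.lt_succ_of_le (last_part_le st fat hm _), ?_, ?_⟩
      · -- there is a non-host part: `npart ≥ 2`
        have hn2 : 2 ≤ npart st (Gen.merge X Y e) := by
          have h1 := one_le_length_clusterParts st (st e) X
          have h2 := one_le_length_clusterParts st (st e) Y
          have : (jparts st (Gen.merge X Y e)).length =
              (clusterParts st (st e) X).length + (clusterParts st (st e) Y).length := by
            rw [jparts_merge, List.length_append, List.length_map, List.length_map]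
          simp only [npart]; omega
        intro h0
        have hlen := congrArg (fun ps => ps.toList.length) h0
        simp only [toList_ofList, List.length_map, Parts.toList, List.length_nil] at hlen
        obtain ⟨i, hi⟩ : ∃ i : Fin (npart st (Gen.merge X Y e)), i ≠ hostIdx st X Y e :=
          Fintype.exists_ne_of_one_lt_card (by simp; omega) _
        have : i ∈ nonhost st X Y e := (mem_nonhost st).2 hi
        rw [List.length_eq_zero_iff.1 hlen] at this
        simp at this
      · rw [Parts.wf_iff, toList_ofList]
        intro x hx
        obtain ⟨i, _, rfl⟩ := List.mem_map.1 hx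
        exact ⟨hparts i, Nat.lt_succ_of_le (last_part_le st fat hm i)⟩
termination_by G => gsize G
decreasing_by
  all_goals first
    | (simp only [gsize]; omega)
    | exact gsize_lt_of_mem_jparts st _ _ (part_mem st _ _)

/-- **CANONICITY OF THE SHAPE** from the displayed sortedness. [folklore] -/
theorem canon_toShape : ∀ G : Gen ε, ShapeSorted st fat G → (toShape st fat G).Canon
  | Gen.born b j, _ => by simp [Shape.Canon]
  | Gen.renew G e h, hs => by
      rw [toShape_renew]; rw [ShapeSorted] at hs; exact canon_toShape G hs
  | Gen.merge X Y e, hs => by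
      rw [ShapeSorted] at hs
      rw [toShape_merge]
      refine ⟨canon_toShape _ (hs.1 _), ?_, by rw [toList_ofList]; exact hs.2⟩
      rw [Parts.canon_iff, toList_ofList]
      intro x hx
      obtain ⟨i, _, rfl⟩ := List.mem_map.1 hx
      exact canon_toShape _ (hs.1 i)
termination_by G => gsize G
decreasing_by
  all_goals first
    | (simp only [gsize]; omega)
    | exact gsize_lt_of_mem_jparts st _ _ (part_mem st _ _)

end

end Summit.QuantumFields.BalabanUV.T4Continuum.HistorySiblingEntropyBridge
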